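import Mathlib
import Literature.Barriers.ValiantsHypothesis.AlgebraicNaturalProofs
import Summits.ValiantsHypothesis.ValiantsHypothesis.Theorems.BarrierLeverSuccinctHittingSetsForVPStubCatalecticantDeterminant
import HarnessLib

/-!
# Crux `BarrierLever.SuccinctHittingSetsForVP` (stmt-ValiantsHypothesis-14610), line `registered` —
stubs `stub_principalMinors` / `stub_principalMinorsHit`: EVERY PRINCIPAL CATALECTICANT MINOR (any
size, any selection of rows of mixed degrees `≤ n/2`) IS NONSINGULAR ON ONE SMALL CIRCUIT

**What is proved (unconditional; evidence for the open item in the direction the crux predicts for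
rank methods; it does NOT close the item).**

* `stub_principalMinors` : for `n ≥ 8` some `f ∈ SmallCircuits ℂ n 8` — the FACTORIAL polynomial
  `f = Σ_{|m| ≤ n} (∏_l m_l!) x^m` of `CatalecticantMaximal.exists_factorial_mem_smallCircuits` —
  has `det [coeff_{u_i + u_j} f]_{i, j} ≠ 0` for EVERY finite injective family of exponent vectors
  `u : ι ↪ ℕ^n` with `2|u_i| ≤ n` (so that `|u_i + u_j| ≤ n`).
* `stub_principalMinorsHit` : the hitting-set form — `SmallCircuits ℂ n 8` hits every polynomial in
  the coefficient variables whose value at every coefficient vector is such a principal minor.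

This generalises the landed `stub_catalecticantDeterminant` (square block on the slice
`|u| = |w| = k`) to arbitrary row selections of mixed degrees.

**Proof.** With that witness `R[i, j] = ∏_l (u_i l + u_j l)!`, a matrix of natural numbers, so it
suffices to work over `ℚ` (`Rat.cast_det`). By the Cholesky factorisation of the Laguerre moment
matrix, `(a + b)! = Σ_t (a! C(a, t)) (b! C(b, t))`, taken coordinatewise
(`CatalecticantDeterminant.sum_prod_factorial_mul_choose`), `R = G Gᵀ` with
`G[i, t] = ∏_l (u_i l)! C(u_i l, t_l)`, columns `t : Fin n → Fin (K + 1)` for any bound `u_i l ≤ K`.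
The rows of `G` (indexed by DISTINCT exponent vectors) are independent: if `v ᵥ* G = 0` and `v ≠ 0`,
pick `i₀` with `v i₀ ≠ 0` MAXIMISING `|u_{i₀}|` (`Finset.exists_max_image`); the column
`t = u_{i₀}` of `G` has entry `∏_l (u_i l)! C(u_i l, u_{i₀} l)`, which vanishes unless
`u_{i₀} ≤ u_i` coordinatewise, and then `|u_{i₀}| ≤ |u_i| ≤ |u_{i₀}|` (maximality) forces
`u_i = u_{i₀}` (`RisingDiagonal.eq_of_forall_le_of_degree_eq`), i.e. `i = i₀` by injectivity; so
that coordinate of `v ᵥ* G` is `v i₀ ∏_l (u_{i₀} l)! ≠ 0`, a contradiction. Hence `det R = 0` is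
impossible: a kernel vector `v ≠ 0` (`Matrix.exists_mulVec_eq_zero_iff`) would give
`‖v ᵥ* G‖² = vᵀ G Gᵀ v = 0`, so `v ᵥ* G = 0`, so `v = 0`. Axioms: `propext`, `Classical.choice`,
`Quot.sound`.

References: Sylvester 1851/52 (catalecticants); Stieltjes moment matrices / Gram matrices;
[ForbesShpilkaVolk2018] §1.2 (rank methods are algebraically natural), Question 6.
-/

-- layout Summits/ValiantsHypothesis/ValiantsHypothesis forces the duplicated namespace component
set_option linter.dupNamespace false

namespace Summit.ValiantsHypothesis.ValiantsHypothesis.Theorems.BarrierLever.SuccinctHittingSetsForVP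

open Literature.Barriers.ValiantsHypothesis Literature.Computability.AlgebraicComplexity MvPolynomial

namespace PrincipalMinors

/-- **`R = G Gᵀ`** for an arbitrary family of rows: the principal catalecticant block
`R[i, j] = ∏_l (u_i l + u_j l)!` is the Gram matrix of the rows of
`G[i, t] = ∏_l (u_i l)! C(u_i l, t_l)` (`t : Fin n → Fin (K + 1)`, any bound `u_i l ≤ K`).
[folklore] -/
theorem of_prod_factorial_eq_mul_transpose {n K : ℕ} {ι : Type*} [Fintype ι]
    (u : ι → (Fin n →₀ ℕ)) (hu : ∀ i l, u i l ≤ K) :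
    (Matrix.of fun i j : ι => ∏ l, (((u i + u j) l).factorial : ℚ)) =
      (Matrix.of fun (i : ι) (t : Fin n → Fin (K + 1)) =>
          ∏ l, (((u i l).factorial * (u i l).choose (t l : ℕ) : ℕ) : ℚ)) *
        (Matrix.of fun (i : ι) (t : Fin n → Fin (K + 1)) =>
          ∏ l, (((u i l).factorial * (u i l).choose (t l : ℕ) : ℕ) : ℚ)).transpose := by
  ext i j
  rw [Matrix.mul_apply]
  simp only [Matrix.of_apply, Matrix.transpose_apply]
  exact (CatalecticantDeterminant.sum_prod_factorial_mul_choose (u i) (u j) (hu i)).symm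

/-- The entry `G[u, u₀] = ∏_l u_l! C(u_l, u₀_l)` vanishes unless `u₀ ≤ u` coordinatewise.
[folklore] -/
theorem prod_factorial_mul_choose_eq_zero_of_not_le {n : ℕ} {u u₀ : Fin n →₀ ℕ}
    (h : ¬ ∀ l, u₀ l ≤ u l) : ∏ l, (((u l).factorial * (u l).choose (u₀ l) : ℕ) : ℚ) = 0 := by
  obtain ⟨l, hl⟩ := not_forall.mp h
  exact Finset.prod_eq_zero (Finset.mem_univ l)
    (by rw [Nat.choose_eq_zero_of_lt (not_le.mp hl), mul_zero, Nat.cast_zero])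

/-- Coordinatewise `u₀ ≤ u` gives `|u₀| ≤ |u|`. [folklore] -/
theorem degree_le_degree_of_forall_le {n : ℕ} {u u₀ : Fin n →₀ ℕ} (hle : ∀ l, u₀ l ≤ u l) :
    u₀.degree ≤ u.degree := by
  rw [Finsupp.degree_eq_sum, Finsupp.degree_eq_sum]
  exact Finset.sum_le_sum fun l _ => hle l

/-- **The rows of `G` indexed by distinct exponent vectors are independent**: `v ᵥ* G = 0 → v = 0`
(evaluate at the column `t = u_{i₀}` for an `i₀ ∈ supp v` of maximal degree, where the column of
`G` restricted to `supp v` is supported on the single row `i₀`). [folklore] -/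
theorem eq_zero_of_vecMul_eq_zero {n K : ℕ} {ι : Type*} [Fintype ι] (u : ι → (Fin n →₀ ℕ))
    (hinj : Function.Injective u) (hu : ∀ i l, u i l ≤ K) (v : ι → ℚ)
    (hv : Matrix.vecMul v
        (Matrix.of fun (i : ι) (t : Fin n → Fin (K + 1)) =>
          ∏ l, (((u i l).factorial * (u i l).choose (t l : ℕ) : ℕ) : ℚ)) = 0) :
    v = 0 := by
  by_contra hne
  obtain ⟨i₁, hi₁⟩ := Function.ne_iff.mp hne
  obtain ⟨i₀, hi₀, hmax⟩ := Finset.exists_max_image (Finset.univ.filter fun i => v i ≠ 0)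
    (fun i => (u i).degree) ⟨i₁, Finset.mem_filter.mpr ⟨Finset.mem_univ _, hi₁⟩⟩
  have hv₀ : v i₀ ≠ 0 := (Finset.mem_filter.mp hi₀).2
  have hlt : ∀ l, u i₀ l < K + 1 := fun l => Nat.lt_succ_of_le (hu i₀ l)
  have h := congrFun hv (fun l => ⟨u i₀ l, hlt l⟩)
  simp only [Matrix.vecMul, dotProduct, Matrix.of_apply, Pi.zero_apply] at h
  rw [Finset.sum_eq_single i₀] at h
  · exact hv₀ ((mul_eq_zero.mp h).resolve_right
      (CatalecticantDeterminant.prod_factorial_mul_choose_self_ne_zero (u i₀)))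
  · intro i _ hi
    by_cases hvi : v i = 0
    · rw [hvi, zero_mul]
    · have hnle : ¬ ∀ l, u i₀ l ≤ u i l := fun hle =>
        hi (hinj (RisingDiagonal.eq_of_forall_le_of_degree_eq hle (le_antisymm
          (hmax i (Finset.mem_filter.mpr ⟨Finset.mem_univ _, hvi⟩))
          (degree_le_degree_of_forall_le hle))))
      rw [prod_factorial_mul_choose_eq_zero_of_not_le hnle, mul_zero]
  · intro h'
    exact absurd (Finset.mem_univ i₀) h'

/-- **Every principal catalecticant minor of the factorial polynomial is nonsingular** (over `ℚ`):
`det [∏_l (u_i l + u_j l)!]_{i, j} ≠ 0` for an injective family `u` — a kernel vector `v` of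
`R = G Gᵀ` has `‖v ᵥ* G‖² = vᵀ R v = 0`, hence `v ᵥ* G = 0`, hence `v = 0`. [folklore] -/
theorem det_of_prod_factorial_ne_zero {n : ℕ} {ι : Type*} [Fintype ι] [DecidableEq ι]
    (u : ι → (Fin n →₀ ℕ)) (hinj : Function.Injective u) :
    (Matrix.of fun i j : ι => ∏ l, (((u i + u j) l).factorial : ℚ)).det ≠ 0 := by
  intro hdet
  obtain ⟨v, hv0, hv⟩ := Matrix.exists_mulVec_eq_zero_iff.mpr hdet
  have hu : ∀ i l, u i l ≤ Finset.univ.sup fun i => (u i).degree := fun i l =>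
    (Finsupp.le_degree l (u i)).trans
      (Finset.le_sup (f := fun i => (u i).degree) (Finset.mem_univ i))
  rw [of_prod_factorial_eq_mul_transpose u hu, ← Matrix.mulVec_mulVec, Matrix.mulVec_transpose]
    at hv
  have h := congrArg (dotProduct v) hv
  rw [dotProduct_zero, Matrix.dotProduct_mulVec, dotProduct_self_eq_zero] at h
  exact hv0 (eq_zero_of_vecMul_eq_zero u hinj hu v h)

end PrincipalMinors

open CatalecticantMaximal PrincipalMinors in
/-- **Registered stub `stub_principalMinors`** (crux stmt-ValiantsHypothesis-14610, line
`registered`; wave 10): for `n ≥ 8` some `f ∈ SmallCircuits ℂ n 8` (the factorial polynomial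
`f = Σ_{|m| ≤ n} (∏_l m_l!) x^m`) has `det [coeff_{u_i + u_j} f]_{i, j} ≠ 0` for EVERY finite
injective family `u : ι ↪ ℕ^n` with `2|u_i| ≤ n`: every principal catalecticant minor — of any size
and any selection of rows — is the positive-definite Gram matrix `[∏_l (u_i l + u_j l)!]`, hence is
hit by one small circuit. [cite: ForbesShpilkaVolk2018, §1.2] -/
theorem stub_principalMinors :
    ∀ n : ℕ, 8 ≤ n → ∃ f ∈ SmallCircuits ℂ n 8,
      ∀ (ι : Type) [Fintype ι] [DecidableEq ι] (u : ι → (Fin n →₀ ℕ)), Function.Injective u →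
        (∀ i, 2 * (u i).degree ≤ n) →
        (Matrix.of fun i j : ι => MvPolynomial.coeff (u i + u j) f).det ≠ 0 := by
  intro n hn
  obtain ⟨f, hf, hcoef⟩ := exists_factorial_mem_smallCircuits n hn
  refine ⟨f, hf, ?_⟩
  intro ι _ _ u hinj hdeg
  have hM : (Matrix.of fun i j : ι => MvPolynomial.coeff (u i + u j) f) =
      (Matrix.of fun i j : ι => ∏ l, (((u i + u j) l).factorial : ℚ)).map
        (fun x : ℚ => (x : ℂ)) := by
    ext i j
    have hd : (u i + u j).degree ≤ n := by
      rw [map_add]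
      have hi := hdeg i
      have hj := hdeg j
      omega
    simp only [Matrix.map_apply, Matrix.of_apply, Rat.cast_prod, Rat.cast_natCast]
    exact hcoef _ hd
  rw [hM, ← Rat.cast_det, Rat.cast_ne_zero]
  exact det_of_prod_factorial_ne_zero u hinj

/-- **Registered stub `stub_principalMinorsHit`** (hitting-set form of `stub_principalMinors`): for
`n ≥ 8`, `SmallCircuits ℂ n 8` hits every polynomial in the coefficient variables whose value at
every coefficient vector is a principal catalecticant minor `det [coeff_{u_i + u_j} f]`
(`u` injective, `2|u_i| ≤ n`) — one witness for all of them. [cite: ForbesShpilkaVolk2018, §1.2] -/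
theorem stub_principalMinorsHit :
    ∀ n : ℕ, 8 ≤ n →
      IsSuccinctHittingSet (degLEMonomials n) (SmallCircuits ℂ n 8)
        {D | ∃ (ι : Type) (_ : Fintype ι) (_ : DecidableEq ι) (u : ι → (Fin n →₀ ℕ)),
          Function.Injective u ∧ (∀ i, 2 * (u i).degree ≤ n) ∧
          ∀ f : MvPolynomial (Fin n) ℂ, MvPolynomial.eval (coeffVector (degLEMonomials n) f) D =
            (Matrix.of fun i j : ι => MvPolynomial.coeff (u i + u j) f).det} := by
  intro n hn
  obtain ⟨f, hf, hdet⟩ := stub_principalMinors n hn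
  intro D hD _
  obtain ⟨ι, _, _, u, hinj, hdeg, hD⟩ := hD
  refine ⟨f, hf, ?_⟩
  rw [hD f]
  exact hdet ι u hinj hdeg

end Summit.ValiantsHypothesis.ValiantsHypothesis.Theorems.BarrierLever.SuccinctHittingSetsForVP
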